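import Summits.CriticalPhenomena.CardyFormulaZ2.Theses.CardyQContinuation
import Literature.Probability.LatticeModels.FermionicObservable

/-! Strategist sketch: first lemmas of the two crux ideas (must elaborate; not proved here). -/

namespace Summit.CriticalPhenomena.CardyFormulaZ2.Cruxes.IsingJetsConformal.Strategist

open scoped BigOperators Topology Classical
open Filter Set MeasureTheory
open Literature.Probability.LatticeModels Literature.Probability.RandomPlanarGeometry
  Literature.Probability.Percolation

/-- The loop-number exponent of the crux weight: `L(ω) = |ω| + 2 k_B(ω)` (Grimmett 2006 (3.75):
`= #loops + const` on the medial graph). -/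
noncomputable def loopExponent (R : ConformalRectangle) (δ : ℝ) (ω : Set (Sym2 (Site 2))) : ℕ :=
  ω.ncard + 2 * Nat.card ((openGraph ω ⊔ wired (discreteArc R.carrier δ (R.arc 0) ∪
    discreteArc R.carrier δ (R.arc 2))).induce (meshDomain R.carrier δ)).ConnectedComponent

/-- The crux weight `w R δ s ω = s ^ L(ω)`. -/
noncomputable def cruxWeight (R : ConformalRectangle) (δ : ℝ) (s : ℂ) (ω : Set (Sym2 (Site 2))) : ℂ :=
  s ^ loopExponent R δ ω

/-- Partition function `Z`, crossing numerator `N` and the `L`-weighted sums of the crux. -/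
noncomputable def Zsum (R : ConformalRectangle) (δ : ℝ) (s : ℂ) : ℂ :=
  ∑ᶠ ω ∈ 𝒫 (discreteDomainGraph R.carrier δ).edgeSet, cruxWeight R δ s ω
noncomputable def Nsum (R : ConformalRectangle) (δ : ℝ) (s : ℂ) : ℂ :=
  ∑ᶠ ω ∈ 𝒫 (discreteDomainGraph R.carrier δ).edgeSet,
    (discreteCrossing R.carrier δ (R.arc 0) (R.arc 2)).indicator (cruxWeight R δ s) ω
noncomputable def ZLsum (R : ConformalRectangle) (δ : ℝ) (s : ℂ) : ℂ :=
  ∑ᶠ ω ∈ 𝒫 (discreteDomainGraph R.carrier δ).edgeSet, (loopExponent R δ ω : ℂ) * cruxWeight R δ s ω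
noncomputable def NLsum (R : ConformalRectangle) (δ : ℝ) (s : ℂ) : ℂ :=
  ∑ᶠ ω ∈ 𝒫 (discreteDomainGraph R.carrier δ).edgeSet,
    (discreteCrossing R.carrier δ (R.arc 0) (R.arc 2)).indicator
      (fun ω ↦ (loopExponent R δ ω : ℂ) * cruxWeight R δ s ω) ω

/-- The crux crossing ratio `P R δ s = N / Z` (definitionally the route's `P`). -/
noncomputable def Pratio (R : ConformalRectangle) (δ : ℝ) (s : ℂ) : ℂ := Nsum R δ s / Zsum R δ s

/-- FIRST LEMMA of idea `pairing-cutoff` (the exact pairing identity): wherever `Z(s) ≠ 0`,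
`s · P'(s) = E_s[1_U · L] - P(s) · E_s[L] = Cov_s(1_U, L)` — the first jet is the covariance of the
crossing indicator with the loop number, i.e. `P(1-P)(E[L|U] - E[L|Uᶜ])` for real `s > 0`. -/
def PairingIdentity : Prop :=
  ∀ (R : ConformalRectangle) (δ : ℝ), 0 < δ → ∀ s : ℂ, Zsum R δ s ≠ 0 → s ≠ 0 →
    HasDerivAt (Pratio R δ)
      (s⁻¹ * (NLsum R δ s / Zsum R δ s - Pratio R δ s * (ZLsum R δ s / Zsum R δ s))) s

/-- Idea `pairing-cutoff`, typed obstruction / first stub of a would-be line (n = 1): the centred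
loop-number covariance is bounded uniformly in the mesh for every rectangle.  (Equivalent, by
`PairingIdentity`, to boundedness of the first jet; its failure for one `R` refutes the crux.) -/
def FirstJetBounded : Prop :=
  ∀ R : ConformalRectangle, ∃ C : ℝ, ∀ δ : ℝ, 0 < δ → δ < 1 →
    ‖NLsum R δ (Real.sqrt 2) / Zsum R δ (Real.sqrt 2)
      - Pratio R δ (Real.sqrt 2) * (ZLsum R δ (Real.sqrt 2) / Zsum R δ (Real.sqrt 2))‖ ≤ C

/-- FIRST LEMMA of idea `fugacity-derivative-sholo` (Dobrushin 2-arc toy rung of the transfer):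
the spin-½ FK fermionic observable along the critical self-dual family `q ↦ (p_sd(q), q)`,
`F_q(z) = E_{p_sd(q), q}[passages · e^{-iW/2}]`, is differentiable in `q` at `q = 2` for every
finite discrete Dobrushin domain (finite sum of smooth functions of `q`); its derivative is the
object `G = ∂_q F` whose s-holomorphicity DEFECT the idea proposes to control. -/
def DobrushinObservableDifferentiable : Prop :=
  ∀ (D : DiscreteDobrushin) [Fintype (meshDomain D.Ω D.δ)] (z : MedialVertex),
    DifferentiableAt ℝ (fun q : ℝ ↦
      ∫ ω, passageSum (fkInterface D ω) D.δ (1 / 2) z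
        ∂(D.fkInterfaceMeasure (Real.sqrt q / (1 + Real.sqrt q)) q)) 2

/-- The transfer's load-bearing claim at toy level (Dobrushin, 2 arcs), stated as a defect bound:
for the `q`-derivative `G` of the normalised observable the s-holomorphicity defect at interior
corners, summed absolutely over the domain, is `O(1)` uniformly in the mesh — the statement the
census shows is FALSE in absolute value (pointwise defect `~ δ^{1/2}`, `δ^{-2}` corners) and must be
replaced by a signed/phase cancellation; recorded here only to make the obstruction checkable. -/
def DefectAbsolutelySummable : Prop :=
  ∀ (D : DiscreteDobrushin) [Fintype (meshDomain D.Ω D.δ)], ∃ C : ℝ,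
    let G : MedialVertex → ℂ := fun z ↦ deriv (fun q : ℝ ↦
      ∫ ω, passageSum (fkInterface D ω) D.δ (1 / 2) z
        ∂(D.fkInterfaceMeasure (Real.sqrt q / (1 + Real.sqrt q)) q)) 2
    ∀ v f, IsCorner v f → cornerSource v f ∈ D.innerMedialVertices →
      cornerTarget v f ∈ D.innerMedialVertices →
      ‖projLine (cornerLine v f) (G (cornerSource v f)) -
        projLine (cornerLine v f) (G (cornerTarget v f))‖ ≤ C * D.δ ^ (1 / 2 : ℝ)

end Summit.CriticalPhenomena.CardyFormulaZ2.Cruxes.IsingJetsConformal.Strategist
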